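import Summits.ResolutionOfSingularities.ResolutionOfSingularities.Theses.WeightedInvariant
import Literature.AlgebraicGeometry.Resolution.ResolutionProjectiveReduction
import Literature.AlgebraicGeometry.Resolution.AlterationsStrong
import Literature.AlgebraicGeometry.Motives.VarietiesProjectiveSpaceProofs
import Literature.AlgebraicGeometry.Motives.VarietiesProperProofs

/-!
# `DatumToEmbedded` — negative lemmas I: position in the implication web

Support (negative) lemmas for crux `stmt-ResolutionOfSingularities-0572`
(`Summit.ResolutionOfSingularities.ResolutionOfSingularities.Theses.WeightedInvariant.DatumToEmbedded`:
for every prime `p`, a weighted resolution datum in characteristic `p` resolves every INTEGRAL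
closed subscheme of every smooth separated quasi-compact scheme over every PERFECT field of
characteristic `p`), filed by the standing disprover (cdisprove gen 1, cycle 1; work file
`Cruxes/DatumToEmbedded/Disproof.lean`). No definition is declared (variants of the conclusion
block are written out inline) and no theorem asserts a Theses decl positively. Companion files:
`Negative/LoadBearingHypotheses.lean` (dropped hypotheses), `Negative/StrengtheningIsRegular.lean`.

* `embedded_of_plain` / `plain_of_embedded` (any field `k`): resolution of reduced separated
  finite-type `k`-schemes ⇔ resolution of integral closed subschemes of smooth separated
  quasi-compact `k`-schemes (←: `ℙⁿ_k` smooth and proper + the tree's projective reduction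
  `ResolutionOverUpToDim.of_projective`: components, Chow, projective closure).
* `datumToEmbedded_iff_construction_imp_thesis` — the crux is EXACTLY "∀ p prime, (datum at `p`) →
  (resolution over perfect fields of characteristic `p`)". Hence
  `not_weightedThesis_of_not_datumToEmbedded`, `not_summit_of_not_datumToEmbedded` (a kill refutes the
  route target and the summit), `construction_and_counterexample_of_not_datumToEmbedded` (a kill
  exhibits, at ONE prime, a datum — settling stmt-0571 positively there — AND a counterexample to
  resolution over a perfect field), `datumToEmbedded_iff_weightedThesis_of_construction` (given
  `WeightedConstruction` the crux IS the route target), `datumToEmbedded_without_datum_iff_weightedThesis`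
  (the datum hypothesis is the only distance to the open problem: any proof must use it),
  `datumToEmbedded_iff_minimalCase` (modulo the named fact `CossartPiltant2019` the resolution half
  of a kill is an integral closed subscheme of some `ℙⁿ_k` of dimension `≥ 4`).
* `datumToEmbedded_conclusion_iff_reduced`: `IsIntegral X` may be WEAKENED to `IsReduced X`
  (components); `datumToEmbedded_conclusion_finiteType_iff`: with `Smooth f ↦ LocallyOfFiniteType f`
  the block is plain resolution again (smoothness of the ambient `Y` serves the proof, not the
  statement); `datumToEmbedded_conclusion_without_perfect_iff_summit`: `[PerfectField k]` dropped in
  the block is literally the summit; `datumToEmbedded_without_prime_iff` (+ `…_iff_crux`): `p.Prime`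
  is decoration modulo `Hironaka1964`.

## Sources
* V. Cossart, O. Piltant, J. Algebra 529 (2019), proof of Prop. 4.6, Steps 1–3 (projective
  reduction, in tree as `ResolutionOverUpToDim.of_projective`) and Thm. 1.1 (`CossartPiltant2019`).
* R. Hartshorne, *Algebraic Geometry*, III §10 Example 10.0.1 (`ℙⁿ` smooth; in tree).
* H. Hironaka, Ann. of Math. 79 (1964), Main Theorem I (named fact `Hironaka1964`).
-/

noncomputable section

open CategoryTheory AlgebraicGeometry TopologicalSpace
open Literature.AlgebraicGeometry.Resolution
open Summit.ResolutionOfSingularities.ResolutionOfSingularities.Theses.WeightedInvariant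

set_option linter.dupNamespace false

namespace Summit.ResolutionOfSingularities.ResolutionOfSingularities.Theorems.DatumToEmbedded.Negative

/-! ## §1 Embedded ⇔ plain resolution over a field -/

/-- **Embedded ⇐ plain, over any field.** If every reduced separated `k`-scheme of finite type has
a resolution then so does every integral closed subscheme of a smooth separated quasi-compact
`k`-scheme (`X → Y → Spec k` is separated, locally of finite type, quasi-compact; integral ⇒
reduced). [folklore] -/
theorem embedded_of_plain (k : Type) [Field k]
    (h : ∀ (X : Scheme.{0}) (f : X ⟶ Spec (.of k)), IsSeparated f → LocallyOfFiniteType f →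
      QuasiCompact f → IsReduced X → Scheme.HasResolution X)
    (Y X : Scheme.{0}) (f : Y ⟶ Spec (.of k)) (i : X ⟶ Y) [Smooth f] [IsSeparated f]
    [QuasiCompact f] [IsClosedImmersion i] [IsIntegral X] : Scheme.HasResolution X :=
  h X (i ≫ f) inferInstance inferInstance inferInstance inferInstance

/-- **Plain ⇐ embedded, over any field**: if every integral closed subscheme of every smooth
separated quasi-compact `k`-scheme has a resolution, then every reduced separated `k`-scheme of
finite type has one — the `ℙⁿ_k` are smooth (`isSmoothProjective_projectiveSpace_holds`) and proper
(`isProper_projectiveSpace`), and the projective integral case suffices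
(`ResolutionOverUpToDim.of_projective`: components, Chow's lemma, projective closure).
[cite: CossartPiltant2019, Prop. 4.6 (proof, Steps 1–3)] -/
theorem plain_of_embedded (k : Type) [Field k]
    (h : ∀ (Y X : Scheme.{0}) (f : Y ⟶ Spec (.of k)) (i : X ⟶ Y), Smooth f → IsSeparated f →
      QuasiCompact f → IsClosedImmersion i → IsIntegral X → Scheme.HasResolution X)
    (X : Scheme.{0}) (f : X ⟶ Spec (.of k)) [IsSeparated f] [hlft : LocallyOfFiniteType f]
    [hqc : QuasiCompact f] [IsReduced X] : Scheme.HasResolution X := by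
  haveI : CompactSpace X := QuasiCompact.compactSpace_of_compactSpace f
  obtain ⟨d, hd⟩ := exists_topologicalKrullDim_le_of_locallyOfFiniteType f
  refine ResolutionOverUpToDim.of_projective (k := k) (d := d) (fun n Z ι hι hint _ => ?_) X f
    inferInstance hlft hqc inferInstance hd
  haveI : IsProper (Literature.AlgebraicGeometry.Motives.projectiveSpace n k).hom :=
    Literature.AlgebraicGeometry.Motives.isProper_projectiveSpace n k
  haveI : SmoothOfRelativeDimension n (Literature.AlgebraicGeometry.Motives.projectiveSpace n k).hom :=
    (Literature.AlgebraicGeometry.Motives.isSmoothProjective_projectiveSpace_holds k n)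
      |>.smoothOfRelativeDimension
  haveI : Smooth (Literature.AlgebraicGeometry.Motives.projectiveSpace n k).hom :=
    SmoothOfRelativeDimension.smooth n _
  exact h _ Z (Literature.AlgebraicGeometry.Motives.projectiveSpace n k).hom ι inferInstance
    inferInstance inferInstance hι hint

/-! ## §2 Position in the web -/

/-- **The crux is exactly "construction ⇒ thesis, prime by prime".** [folklore] -/
theorem datumToEmbedded_iff_construction_imp_thesis :
    DatumToEmbedded ↔
      ∀ p : ℕ, p.Prime → Nonempty (WeightedResolutionDatum p) →
        ∀ (k : Type) [Field k] [CharP k p] [PerfectField k] (X : Scheme.{0}) (f : X ⟶ Spec (.of k)),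
          IsSeparated f → LocallyOfFiniteType f → QuasiCompact f → IsReduced X →
            Scheme.HasResolution X := by
  refine forall_congr' fun p => forall_congr' fun _ => forall_congr' fun _ => ?_
  constructor
  · intro h k _ _ _ X f hsep hlft hqc hred
    exact plain_of_embedded k (fun Y X f i a b c d e => h k Y X f i a b c d e) X f
  · intro h k _ _ _ Y X f i hf hsep hqc hi hint
    exact embedded_of_plain k (fun X f a b c d => h k X f a b c d) Y X f i

/-- **A kill of the crux kills the route target `WeightedThesis`.** [folklore] -/
theorem not_weightedThesis_of_not_datumToEmbedded (h : ¬ DatumToEmbedded) : ¬ WeightedThesis :=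
  fun hT => h (datumToEmbedded_iff_construction_imp_thesis.mpr fun p hp _ => hT p hp)

/-- **A kill of the crux is a counterexample to resolution of singularities in positive
characteristic**: `¬ crux → ¬ summit`. [folklore] -/
theorem not_summit_of_not_datumToEmbedded (h : ¬ DatumToEmbedded) :
    ¬ _root_.ResolutionOfSingularities :=
  fun hs => not_weightedThesis_of_not_datumToEmbedded h
    fun p hp k _ _ _ X f a b c d => hs p hp k X f a b c d

/-- **What a kill must exhibit, at ONE prime: a weighted resolution datum AND a counterexample to
resolution over a perfect field.** [folklore] -/
theorem construction_and_counterexample_of_not_datumToEmbedded (h : ¬ DatumToEmbedded) :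
    ∃ p : ℕ, p.Prime ∧ Nonempty (WeightedResolutionDatum p) ∧
      ¬ ∀ (k : Type) [Field k] [CharP k p] [PerfectField k] (X : Scheme.{0}) (f : X ⟶ Spec (.of k)),
          IsSeparated f → LocallyOfFiniteType f → QuasiCompact f → IsReduced X →
            Scheme.HasResolution X := by
  rw [datumToEmbedded_iff_construction_imp_thesis] at h
  obtain ⟨p, hp⟩ := not_forall.mp h
  obtain ⟨hp', h'⟩ := Classical.not_imp.mp hp
  obtain ⟨hD, hres⟩ := Classical.not_imp.mp h'
  exact ⟨p, hp', hD, hres⟩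

/-- **Given the construction crux, this crux IS the route target.** [folklore] -/
theorem datumToEmbedded_iff_weightedThesis_of_construction (hC : WeightedConstruction) :
    DatumToEmbedded ↔ WeightedThesis :=
  ⟨fun h p hp => datumToEmbedded_iff_construction_imp_thesis.mp h p hp (hC p hp),
    fun hT => datumToEmbedded_iff_construction_imp_thesis.mpr fun p hp _ => hT p hp⟩

/-- If the crux holds and the target fails, the construction crux fails. [folklore] -/
theorem not_construction_of_datumToEmbedded_of_not_weightedThesis (hE : DatumToEmbedded)
    (hT : ¬ WeightedThesis) : ¬ WeightedConstruction :=
  fun hC => hT ((datumToEmbedded_iff_weightedThesis_of_construction hC).mp hE)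

/-- **Without the datum hypothesis the crux is literally the route target `WeightedThesis`** (the
resolution conjecture over perfect fields): any proof must use the datum. [folklore] -/
theorem datumToEmbedded_without_datum_iff_weightedThesis :
    (∀ p : ℕ, p.Prime →
        ∀ (k : Type) [Field k] [CharP k p] [PerfectField k] (Y X : Scheme.{0})
          (f : Y ⟶ Spec (.of k)) (i : X ⟶ Y), Smooth f → IsSeparated f → QuasiCompact f →
            IsClosedImmersion i → IsIntegral X → Scheme.HasResolution X) ↔
      WeightedThesis := by
  refine forall_congr' fun p => forall_congr' fun _ => ?_
  constructor
  · intro h k _ _ _ X f hsep hlft hqc hred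
    exact plain_of_embedded k (fun Y X f i a b c d e => h k Y X f i a b c d e) X f
  · intro h k _ _ _ Y X f i hf hsep hqc hi hint
    exact embedded_of_plain k (fun X f a b c d => h k X f a b c d) Y X f i

/-- **Modulo `CossartPiltant2019` the crux reads: a datum at `p` resolves every integral closed
subscheme of dimension `≥ 4` of every `ℙⁿ_k`, `k` perfect of characteristic `p`** — so the
resolution half of a kill is a projective variety of dimension at least four over a perfect field
without resolution. [cite: CossartPiltant2019, Thm. 1.1] -/
theorem datumToEmbedded_iff_minimalCase (hCP : CossartPiltant2019.{0}) :
    DatumToEmbedded ↔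
      ∀ p : ℕ, p.Prime → Nonempty (WeightedResolutionDatum p) →
        ∀ (k : Type) [Field k] [CharP k p] [PerfectField k] (n : ℕ) (X : Scheme.{0})
          (ι : X ⟶ (Literature.AlgebraicGeometry.Motives.projectiveSpace n k).left),
            IsClosedImmersion ι → IsIntegral X → ¬ topologicalKrullDim X ≤ 3 →
              Scheme.HasResolution X := by
  rw [datumToEmbedded_iff_construction_imp_thesis]
  refine forall_congr' fun p => forall_congr' fun _ => forall_congr' fun _ => ?_
  constructor
  · intro h k _ _ _ n X ι hι hint _
    haveI := hι
    haveI := hint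
    haveI : IsProper (Literature.AlgebraicGeometry.Motives.projectiveSpace n k).hom :=
      Literature.AlgebraicGeometry.Motives.isProper_projectiveSpace n k
    exact h k X (ι ≫ (Literature.AlgebraicGeometry.Motives.projectiveSpace n k).hom) inferInstance
      inferInstance inferInstance inferInstance
  · intro h k _ _ _ X f hsep hlft hqc hred
    haveI := hlft
    haveI := hqc
    haveI : CompactSpace X := QuasiCompact.compactSpace_of_compactSpace f
    obtain ⟨d, hd⟩ := exists_topologicalKrullDim_le_of_locallyOfFiniteType f
    refine ResolutionOverUpToDim.of_projective (k := k) (d := d) (fun n Z ι hι hint _ => ?_) X f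
      hsep hlft hqc hred hd
    by_cases hdim : topologicalKrullDim Z ≤ 3
    · haveI := hι
      haveI := hint
      haveI : IsProper (Literature.AlgebraicGeometry.Motives.projectiveSpace n k).hom :=
        Literature.AlgebraicGeometry.Motives.isProper_projectiveSpace n k
      exact hCP k Z (ι ≫ (Literature.AlgebraicGeometry.Motives.projectiveSpace n k).hom)
        inferInstance inferInstance inferInstance inferInstance hdim
    · exact h k n Z ι hι hint hdim

/-! ## §3 Hypotheses of the conclusion block that can be weakened or are decoration -/

open Scheme.IdealSheafData in
/-- **But `IsIntegral X` may be WEAKENED to `IsReduced X`**: the block with `IsReduced X` is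
equivalent to the block as stated (→ via §1: the block gives `PerfectResAt p`, which applies to a
reduced closed subscheme of a smooth separated quasi-compact `Y`; ← an integral scheme is reduced).
The exact load carried by `IsIntegral` is therefore "reduced" (generically reduced would do for
`HasResolution`, cf. the line-with-embedded-point `Spec k[x,y]/(x², xy)`, which the normalisation of
its reduction resolves in the sense of `IsBirational`). [folklore] -/
theorem datumToEmbedded_conclusion_iff_reduced (p : ℕ) :
    (∀ (k : Type) [Field k] [CharP k p] [PerfectField k] (Y X : Scheme.{0})
      (f : Y ⟶ Spec (.of k)) (i : X ⟶ Y), Smooth f → IsSeparated f → QuasiCompact f →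
        IsClosedImmersion i → IsIntegral X → Scheme.HasResolution X) ↔
      ∀ (k : Type) [Field k] [CharP k p] [PerfectField k] (Y X : Scheme.{0})
        (f : Y ⟶ Spec (.of k)) (i : X ⟶ Y), Smooth f → IsSeparated f → QuasiCompact f →
          IsClosedImmersion i → IsReduced X → Scheme.HasResolution X := by
  constructor
  · intro h k _ _ _ Y X f i hf hsep hqc hi hred
    haveI := hf; haveI := hsep; haveI := hqc; haveI := hi; haveI := hred
    exact plain_of_embedded k (fun Y X f i a b c d e => h k Y X f i a b c d e) X (i ≫ f)
  · intro h k _ _ _ Y X f i hf hsep hqc hi hint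
    haveI := hint
    exact h k Y X f i hf hsep hqc hi inferInstance

open Scheme.IdealSheafData in
/-- **What `Smooth f` + `IsClosedImmersion i` carry in the STATEMENT is finite type of `X`, nothing
more**: replacing `Smooth f` by `LocallyOfFiniteType f` turns the block into exactly
`PerfectResAt p` (→: `Y = X`, `i = 𝟙` gives the integral case, then irreducible components,
`hasResolution_of_forall_closeds`; ←: a closed subscheme of a separated finite-type `Y` is
separated of finite type). Smoothness of the ambient scheme is used by the PROOF (the datum lives
on smooth `Y`), not by the statement. [folklore] -/
theorem datumToEmbedded_conclusion_finiteType_iff (p : ℕ) :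
    (∀ (k : Type) [Field k] [CharP k p] [PerfectField k] (Y X : Scheme.{0})
        (f : Y ⟶ Spec (.of k)) (i : X ⟶ Y), LocallyOfFiniteType f → IsSeparated f →
          QuasiCompact f → IsClosedImmersion i → IsIntegral X → Scheme.HasResolution X) ↔
      ∀ (k : Type) [Field k] [CharP k p] [PerfectField k] (X : Scheme.{0}) (f : X ⟶ Spec (.of k)),
      IsSeparated f → LocallyOfFiniteType f → QuasiCompact f → IsReduced X →
        Scheme.HasResolution X := by
  constructor
  · intro h k _ _ _ X f hsep hlft hqc hred
    haveI := hsep; haveI := hlft; haveI := hqc; haveI := hred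
    refine hasResolution_of_forall_closeds X f fun Z hZ => ?_
    haveI := hZ
    exact h k X _ f (vanishingIdeal Z).subschemeι hlft hsep hqc inferInstance hZ
  · intro h k _ _ _ Y X f i hlft hsep hqc hi hint
    haveI := hlft; haveI := hsep; haveI := hqc; haveI := hi; haveI := hint
    exact h k X (i ≫ f) inferInstance inferInstance inferInstance inferInstance

/-- **`[PerfectField k]` dropped in the block (all primes together) is literally the summit**:
→ via `plain_of_embedded` (which never used perfectness), ← via `embedded_of_plain`. So inside
the block perfectness is where the whole distance to the summit sits (crux `DescentPerfectToAll`),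
exactly as for the route target. [folklore] -/
theorem datumToEmbedded_conclusion_without_perfect_iff_summit :
    (∀ p : ℕ, p.Prime → ∀ (k : Type) [Field k] [CharP k p] (Y X : Scheme.{0})
        (f : Y ⟶ Spec (.of k)) (i : X ⟶ Y), Smooth f → IsSeparated f → QuasiCompact f →
          IsClosedImmersion i → IsIntegral X → Scheme.HasResolution X) ↔
      _root_.ResolutionOfSingularities := by
  constructor
  · intro h p hp k _ _ X f hsep hlft hqc hred
    haveI := hsep; haveI := hlft; haveI := hqc; haveI := hred
    exact plain_of_embedded k (fun Y X f i a b c d e => h p hp k Y X f i a b c d e) X f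
  · intro hs p hp k _ _ Y X f i hf hsep hqc hi hint
    haveI := hf; haveI := hsep; haveI := hqc; haveI := hi; haveI := hint
    exact embedded_of_plain k (fun X f a b c d => hs p hp k X f a b c d) Y X f i

/-- **`p.Prime` dropped ⇒ `(datum at 0 ⇒ embedded resolution in characteristic 0) ∧ crux`**: no
field has characteristic `1` or a composite characteristic. [folklore] -/
theorem datumToEmbedded_without_prime_iff :
    (∀ p : ℕ, Nonempty (WeightedResolutionDatum p) →
        ∀ (k : Type) [Field k] [CharP k p] [PerfectField k] (Y X : Scheme.{0})
        (f : Y ⟶ Spec (.of k)) (i : X ⟶ Y), Smooth f → IsSeparated f → QuasiCompact f →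
          IsClosedImmersion i → IsIntegral X → Scheme.HasResolution X) ↔
      (Nonempty (WeightedResolutionDatum 0) →
        ∀ (k : Type) [Field k] [CharP k 0] [PerfectField k] (Y X : Scheme.{0})
          (f : Y ⟶ Spec (.of k)) (i : X ⟶ Y), Smooth f → IsSeparated f → QuasiCompact f →
            IsClosedImmersion i → IsIntegral X → Scheme.HasResolution X) ∧ DatumToEmbedded := by
  constructor
  · intro h
    exact ⟨h 0, fun p _ => h p⟩
  · rintro ⟨h0, h⟩ p hD k _ _ _ Y X f i hf hsep hqc hi hint
    rcases CharP.char_is_prime_or_zero k p with hp | rfl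
    · exact h p hp hD k Y X f i hf hsep hqc hi hint
    · exact h0 hD k Y X f i hf hsep hqc hi hint

/-- **Modulo Hironaka's theorem `p.Prime` is decoration**: `Hironaka1964` gives the `p = 0`
conjunct outright, datum or not. [cite: Hironaka1964, Main Theorem I] -/
theorem datumToEmbedded_without_prime_iff_crux (hH : Hironaka1964.{0}) :
    (∀ p : ℕ, Nonempty (WeightedResolutionDatum p) →
        ∀ (k : Type) [Field k] [CharP k p] [PerfectField k] (Y X : Scheme.{0})
        (f : Y ⟶ Spec (.of k)) (i : X ⟶ Y), Smooth f → IsSeparated f → QuasiCompact f →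
          IsClosedImmersion i → IsIntegral X → Scheme.HasResolution X) ↔
      DatumToEmbedded := by
  rw [datumToEmbedded_without_prime_iff]
  refine ⟨fun h => h.2, fun h => ⟨fun _ k _ _ _ Y X f i hf hsep hqc hi hint => ?_, h⟩⟩
  haveI := hf; haveI := hsep; haveI := hqc; haveI := hi; haveI := hint
  exact embedded_of_plain k (fun X f a b c d => hH k X f a b c d) Y X f i

end Summit.ResolutionOfSingularities.ResolutionOfSingularities.Theorems.DatumToEmbedded.Negative

end
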